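import Mathlib
import HarnessLib

/-!
# Uniform boundedness for pointwise-`O(w)` families of bilinear forms

Support file for the crux item stmt-QuantumFields-8782 (`ContinuumLegGivenGap`, line `Sketch`):
the registered sub-goal `stub_bilinearUBP`, the pure functional-analysis engine of the
"pair-to-norm upgrade" (`BilinearUBP` in the skeleton).

Let `X`, `Y` be real Banach spaces, `b i : X →L[ℝ] Y →L[ℝ] ℝ` a family of continuous bilinear
forms and `w i > 0` weights. If for each pair `(x, y)` ONE constant `C(x, y)` gives
`|b i x y| ≤ C(x, y) · w i` for all `i`, then ONE constant `K` gives
`|b i x y| ≤ K ‖x‖ ‖y‖ · w i` for all `i, x, y`.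

Proof (Banach–Steinhaus twice): for fixed `x` the family `i ↦ (w i)⁻¹ • b i x : Y →L[ℝ] ℝ` is
pointwise bounded, hence bounded in operator norm by some `K(x)` (Banach–Steinhaus on `Y`); so
the family `i ↦ (w i)⁻¹ • b i : X →L[ℝ] (Y →L[ℝ] ℝ)` is pointwise bounded, hence bounded in
operator norm by some `K` (Banach–Steinhaus on `X`); then unfold the two operator norms.

Mathlib only (`banach_steinhaus`, `ContinuousLinearMap.le_opNorm`); no definitions, no facts.
-/

namespace Summit.QuantumFields.YangMills.Theorems.ContinuumLegGivenGap

/-- **Weighted Banach–Steinhaus**: a family `g i : E →L[ℝ] F` on a real Banach space `E` which is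
pointwise `O(w)` (`‖g i x‖ ≤ C(x) · w i`, weights `w i > 0`) is `O(w)` in operator norm
(`‖g i‖ ≤ K · w i`): the rescaled family `(w i)⁻¹ • g i` is pointwise bounded. [folklore] -/
theorem opNorm_le_mul_of_pointwise {E F : Type*} [NormedAddCommGroup E] [NormedSpace ℝ E]
    [CompleteSpace E] [NormedAddCommGroup F] [NormedSpace ℝ F] {ι : Type*} (g : ι → E →L[ℝ] F)
    (w : ι → ℝ) (hw : ∀ i, 0 < w i) (h : ∀ x, ∃ C : ℝ, ∀ i, ‖g i x‖ ≤ C * w i) :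
    ∃ K : ℝ, ∀ i, ‖g i‖ ≤ K * w i := by
  have hg : ∀ x, ∃ C : ℝ, ∀ i, ‖((w i)⁻¹ • g i) x‖ ≤ C := by
    intro x
    obtain ⟨C, hC⟩ := h x
    refine ⟨C, fun i => ?_⟩
    rw [smul_apply, norm_smul, norm_inv, Real.norm_of_nonneg (hw i).le,
      inv_mul_le_iff₀' (hw i)]
    exact hC i
  obtain ⟨K, hK⟩ := banach_steinhaus (g := fun i => (w i)⁻¹ • g i) hg
  refine ⟨K, fun i => ?_⟩
  have hKi : ‖(w i)⁻¹ • g i‖ ≤ K := hK i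
  rwa [norm_smul, norm_inv, Real.norm_of_nonneg (hw i).le, inv_mul_le_iff₀' (hw i)] at hKi

/-- **Uniform boundedness for bilinear families** (registered sub-goal `stub_bilinearUBP` of
stmt-8782; the statement is the body of `BilinearUBP` in the line's skeleton): a family of
continuous bilinear forms on a pair of real Banach spaces which is pointwise `O(w)` is `O(w)` in
operator norm, uniformly over the family — Banach–Steinhaus applied twice
(`opNorm_le_mul_of_pointwise` in `Y` at fixed `x`, then in `X`), followed by
`|b i x y| ≤ ‖b i‖ ‖x‖ ‖y‖`. [folklore] -/
theorem stub_bilinearUBP :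
    ∀ (X Y : Type) [NormedAddCommGroup X] [NormedSpace ℝ X] [CompleteSpace X]
      [NormedAddCommGroup Y] [NormedSpace ℝ Y] [CompleteSpace Y] (ι : Type)
      (b : ι → X →L[ℝ] Y →L[ℝ] ℝ) (w : ι → ℝ), (∀ i, 0 < w i) →
      (∀ x y, ∃ C : ℝ, ∀ i, |b i x y| ≤ C * w i) →
        ∃ K : ℝ, ∀ i x y, |b i x y| ≤ K * ‖x‖ * ‖y‖ * w i := by
  intro X Y _ _ _ _ _ _ ι b w hw h
  -- Step 1 (Banach–Steinhaus on `Y`, at each fixed `x`): `‖b i x‖ ≤ C(x) · w i`.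
  have h1 : ∀ x, ∃ C : ℝ, ∀ i, ‖b i x‖ ≤ C * w i := by
    intro x
    have hx : ∀ y, ∃ C : ℝ, ∀ i, ‖b i x y‖ ≤ C * w i := fun y =>
      (h x y).imp fun C hC i => (Real.norm_eq_abs _).trans_le (hC i)
    exact opNorm_le_mul_of_pointwise (fun i => b i x) w hw hx
  -- Step 2 (Banach–Steinhaus on `X`): `‖b i‖ ≤ K · w i`.
  obtain ⟨K, hK⟩ := opNorm_le_mul_of_pointwise b w hw h1
  -- Step 3: unfold the operator norms.
  refine ⟨K, fun i x y => ?_⟩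
  calc |b i x y| = ‖b i x y‖ := (Real.norm_eq_abs _).symm
    _ ≤ ‖b i x‖ * ‖y‖ := (b i x).le_opNorm y
    _ ≤ ‖b i‖ * ‖x‖ * ‖y‖ := mul_le_mul_of_nonneg_right ((b i).le_opNorm x) (norm_nonneg y)
    _ ≤ K * w i * ‖x‖ * ‖y‖ :=
      mul_le_mul_of_nonneg_right (mul_le_mul_of_nonneg_right (hK i) (norm_nonneg x))
        (norm_nonneg y)
    _ = K * ‖x‖ * ‖y‖ * w i := by ring

end Summit.QuantumFields.YangMills.Theorems.ContinuumLegGivenGap
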